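import Literature.MathematicalPhysics.QuantumFieldTheory.Balaban1983to89.B9Eq326ConjugatedDeltaATwoBackgrounds
import Literature.MathematicalPhysics.QuantumFieldTheory.Balaban1983to89.B9Eq386GreenGroupPencilEnergy

/-!
# `Balaban1983to89.B9Eq326ConjugatedDeltaATwoBackgroundsGroupPencil` — T. Bałaban, *Propagators for lattice gauge theories in a background field*,
# Commun. Math. Phys. **99** (1985) 389–434 [Balaban1985BackgroundPropagators] (3.26) p. 395, Thm 3.4 p. 400, (3.50)–(3.53) p. 400, (3.84)–(3.86) p. 407,
# Thm 3.11 p. 416, with T. Kato (1966) [Kato1966] Ch. VII §4: **THE CONJUGATED `Δ_a`-STRUCTURE ALONG AN ANALYTIC (GROUP) PENCIL — for a family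
# `z ↦ H_κ(U_z) = B′_{1,κ}(z)B_{1,κ}(z) + B′_{2,κ}(z)R_κ(z)B_{2,κ}(z) + K_κ(z) + aQ′_κ(z)Q_κ(z)` analytic on `‖z‖ ≤ R₁` whose letters stay within
# `δ₁, δ₂, δ_R, δ_Q, δ_K` of the (CDA) structure AT THE REAL BASE POINT `U` (sizes at `U` ONLY — no contraction, no unitarity, no coercivity asked of
# any complex member), the inverses `z ↦ H_κ(U_z)⁻¹` are analytic on the disc, bounded by `(γ′ − Θ)⁻¹`, with Cauchy majorants `n!(γ′ − Θ)⁻¹R₁⁻ⁿ`,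
# the resolvent derivative, the energy rows and the LIPSCHITZ bound `(γ′ − Θ)⁻¹∕(R₁ − r)·|z − w|` between any two members** — the group-pencil twin
# of this lineage's `B9Eq326ConjugatedDeltaATwoBackgroundsPencil` (N53's linear pencil), junction of `B9Eq386GreenGroupPencilEnergy` (N54) with
# `B9Eq326ConjugatedDeltaAFormDefect` ∕ `…TwoBackgrounds` ∕ `…EnergyWeight`

statement-level skeleton of published theorems with citation tags; proofs where landed; nothing here is a claim about the Yang–Mills mass gap

CITATION HEADER (lean-in-tree rule).  Audit cell `pub-balaban`, sub-cell `t4`, BINDER row NE9; filed by NE9 formalisation-swarm LEAF PROVER 01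
(`b2b-balaban-t4-ne9-formalise-leaf-01`, gen 89) under t4-ne9-idea-1 gen 153's located note N54 («THE GROUP PENCIL IS TYPE (B) TOO», §3 «LATTICE
JUNCTION … with I-8's letters at the base `U`»; cell journal 2026-08-25 l.64371 ∕ l.64788; card `t4/ideate/NE9/lens1-g153/N54-GROUP-PENCIL-g153.md`).
Imports this lineage's `B9Eq326ConjugatedDeltaATwoBackgrounds` (gen 88; through it `…FormDefect`, `…EnergyWeight`) and `B9Eq386GreenGroupPencilEnergy`
(gen 89).  Sources READ first-hand in the held text layer (`paper:balaban1985-cmp99-background-propagators`, journal page = PDF page + 388): p. 400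
Thm 3.4 (`U′U`, `U′ = e^{iηA}`, *«analytic functions of A»*, *«small perturbations of the operators depending on U only»*), (3.50)–(3.53)
(`Δ_{U′U} = Δ_U − V₁(A)`), p. 407 (3.84)–(3.86) (`G(U′U) = G(U)(I − V(A)G(U))⁻¹`), p. 416 Thm 3.11 (coercivity `γ`, displayed).  Print's road is the
sup-norm Neumann series fed by Thm 3.3; the FORM-currency pencil is the ROUTE's substitute (`t4/ROUTES-NE9.md` §L1.4, N52–N54); nothing of print's
radius is asserted.

WHY THIS FILE (cell context, N54 §3 «lattice junction (M, composition BY NAME)»).  `…TwoBackgroundsPencil` joined TWO conjugated structures `H_κ(U)`,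
`H_κ(V)` by the LINEAR pencil; its form-defect letter `e₂` for the `R`-slot used `V`'s projection letters (`‖R(V)s‖ ≤ ‖s‖`, `‖R_κ(V) − R(V)‖ ≤ ρ`).
Along print's GROUP pencil `U_z = U·e^{zηA}` the complex members have NO contraction `R(U_z)` and no unitarity, so here EVERY size is taken at the real
base point `U` and every complex member enters through DIFFERENCE letters only: §1 `norm_Rk_B₂k_sub_le_weightU_base` re-derives the composite `R`-slot
letter as `(R_κ(z) − R_κ(U))B_{2,κ}(z) + R_κ(U)(B_{2,κ}(z) − B_{2,κ}(U))` with `‖R_κ(U)‖ ≤ 1 + ρ`, `‖B_{2,κ}(z)v‖ ≤ (1 + C_P + β + δ₂)N_U(v)` — price: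
one extra `δ_Rδ₂` in `Θ`.  With that, `…FormDefect.norm_inner_conjH_sub_conjH_le` gives the defect `Θ` UNIFORMLY on the disc (§1 `hD`), `…EnergyWeight.coerciveN_k`
the base coercivity `γ′ = min(¼, γ∕8)` (§1 `hco`), the family's analyticity is ONE displayed binder `hHa`, reduced by §1 `analyticAt_conjH_of_letters` to
analyticity of the eight LETTER families (at the lattice: words in the pencil letters `U(b)e^{wηA(b)}`, `e^{−wηA(b)}U(b)⁻¹` of `B9Eq350GroupPencilLettersEntire`
AND THEIR TRANSPOSES `B9Eq311TracePairing.btrans`, for a PAIR-typed `Δ_{a,k}` chain — print's `Q*`, `Q′*`, `R` ((3.9), (3.19), (3.24)–(3.25)) continue as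
algebraic transposes; the tree's `laplaceAk` chain is adjoint-typed (`Q†`, `starProjection`, `Q′†`), only REAL-analytic along the pencil and agreeing with
the transposes at unitary `U` only (the OWNER's Reality files) — which is why the primed letters `B₁k′Z, B₂k′Z, Qk′Z` here are SEPARATE letters, not
`LinearMap.adjoint`s; that re-typing is the junction's junction, NOT here — ne9-leaf-04 g83's located remark L-leaf04-g83-2), and
`B9Eq386GreenGroupPencilEnergy` §2 is applied BY NAME with `S₀ := H_κ(U)`,
`D(z) := H_κ(U_z) − H_κ(U)` (§2).  The difference letters `δ_•` are CONSTANTS on the disc: at the lattice they are the values at `R₁` of the monotone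
defect functions of `B9Eq350GroupPencilWordDefect` (`(e^{R₁a})^{n_•} − 1`, `η`-free by its §2), per `B9Eq386GreenGroupPencilEnergy.formBound_of_defectFunction`.

WHAT IS PROVED (sorry-free; proof lane — no `def`; [folklore] composition BY NAME + one triangle inequality).
* §1 **`norm_Rk_B₂k_sub_le_weightU_base`** (the `R`-slot composite difference letter from sizes at `U` only), **`analyticAt_conjH_of_letters`** (the
  family `w ↦ H_κ(U_w)` is analytic when its eight letter families are — supplier of the `hHa` binder).
* §2 for the family on `‖z‖ ≤ R₁` under `Θ < γ′`: **`norm_inverse_conjH_gpencil_le`** (`‖H_κ(U_z)⁻¹‖ ≤ (γ′ − Θ)⁻¹`), `analyticAt_inverse_conjH_gpencil`,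
  **`hasDerivAt_inverse_conjH_gpencil`** (`G′(z) = −G(z)·H′(z)·G(z)`), **`norm_iteratedDeriv_inverse_conjH_gpencil_le`** (`n!·(γ′ − Θ)⁻¹∕R₁ⁿ` at the
  base), **`norm_inverse_conjH_gpencil_sub_le`** (`r < R₁`, `‖z‖, ‖w‖ ≤ r` ⟹ `‖H_κ(U_z)⁻¹ − H_κ(U_w)⁻¹‖ ≤ (γ′ − Θ)⁻¹∕(R₁ − r)·‖z − w‖` — TWO BACKGROUNDS ON
  THE PENCIL DIFFER BY A LIPSCHITZ AMOUNT, no weight comparison, no unconjugated letter), `weightU_inverse_conjH_gpencil_apply_le` (rows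
  `N_U(H_κ(U_z)⁻¹y) ≤ (γ′ − Θ)⁻¹‖y‖` — the circle read-out's input for EVERY member).
MODEL ∕ HONEST SCOPE.  (M1) abstract finite-dimensional complex Hilbert letters `E, P, S, F`.  (M2) DISPLAYED: `γ` (Thm 3.11), the (CDA) letters at `U`,
the disc-uniform difference letters `δ_•`, the analyticity binder `hHa`, `R₁`; `Θ` carries the extra `δ_Rδ₂` against `…TwoBackgrounds`' (honest price of
using no `V`-side contraction).  (M3) the Lipschitz constant `(γ′ − Θ)⁻¹∕(R₁ − r)` is per unit of the PENCIL PARAMETER; converting `|z − w|` to a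
background distance is the lattice junction's (`A`'s (3.37) size).  (M4) not print's Thm 3.4 ∕ (3.86) in operator ∕ kernel currency; no rate, no window
evaluated; no lattice object.  NOT NE9 (cell pub-balaban: NE9 NOT PRINTED ∕ NOT PROVED; «NE9 ⇐ the named binders»; row WALLED ON A MODEL (O-NE9-1; #5
UNRULED); spine PROVED 0∕9; rung (B)+1 on a finite T⁴ — NOT infinite volume, NOT mass gap, NOT BetaPertH, NOT Clay).  HONEST DEPENDENCY (cell line):
continuum YM on T⁴ ⇐ BetaPertH ∧ nine spine estimates (0/9 proved); BetaPertH ⇐ (D1) ∧ (D4) ∧ CAP+tail; G-an2-4 gates asym, D1 and NE2/3/4.  NEW file;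
nothing modified.  Net new unproved facts: 0.
-/

noncomputable section

open scoped InnerProductSpace ComplexConjugate
open Metric Set

namespace Literature.MathematicalPhysics.QuantumFieldTheory.Balaban1983to89.B9Eq326ConjugatedDeltaATwoBackgroundsGroupPencil

open B9Eq326ConjugatedDeltaAEnergyWeight (weightU_nonneg norm_le_weightU coerciveN_k)
open B9Eq326ConjugatedDeltaAFormDefect (norm_adjoint_sub_adjoint_le norm_inner_conjH_sub_conjH_le)
open B9Eq326ConjugatedDeltaATwoBackgrounds (norm_B₁k_le_weightU norm_adjoint_B₁k'_le_weightU norm_B₂k_le_weightU norm_Rk_B₂k_le_weightU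
  norm_adjoint_B₂k'_le_weightU abs_mul_norm_Qk_le_weightU abs_mul_norm_adjoint_Qk'_le_weightU)
open B9Eq386GreenGroupPencilEnergy (norm_inverse_apencil_le analyticAt_inverse_apencil hasDerivAt_inverse_apencil
  norm_iteratedDeriv_inverse_apencil_le norm_inverse_sub_inverse_apencil_le weight_inverse_apencil_apply_le)

variable {E : Type*} [NormedAddCommGroup E] [InnerProductSpace ℂ E] [FiniteDimensional ℂ E]
  {P : Type*} [NormedAddCommGroup P] [InnerProductSpace ℂ P] [FiniteDimensional ℂ P]
  {S : Type*} [NormedAddCommGroup S] [InnerProductSpace ℂ S] [FiniteDimensional ℂ S]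
  {F : Type*} [NormedAddCommGroup F] [InnerProductSpace ℂ F] [FiniteDimensional ℂ F]

/-- Composition of two analytic operator-valued maps of one complex variable is analytic (composition is the continuous bilinear map
`ContinuousLinearMap.compL`; Mathlib's `analyticAt_bilinear` ∘ `comp₂`). [folklore] [cite: Kato1966, Ch. VII §1] -/
private theorem analyticAt_clm_comp {X Y Z : Type*} [NormedAddCommGroup X] [NormedSpace ℂ X] [NormedAddCommGroup Y] [NormedSpace ℂ Y]
    [NormedAddCommGroup Z] [NormedSpace ℂ Z] {f : ℂ → (Y →L[ℂ] Z)} {g : ℂ → (X →L[ℂ] Y)} {z : ℂ}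
    (hf : AnalyticAt ℂ f z) (hg : AnalyticAt ℂ g z) : AnalyticAt ℂ (fun w => (f w).comp (g w)) z := by
  have h := ((ContinuousLinearMap.compL ℂ X Y Z).analyticAt_bilinear (f z, g z)).comp₂ hf hg
  simpa only [ContinuousLinearMap.compL_apply] using h

/-! ## §1 The letters: base coercivity, the `R`-slot composite from sizes at `U`, the disc-uniform form defect, analyticity of `D` -/

section GroupPencil

variable {B₁U : E →ₗ[ℂ] P} {B₂U : E →ₗ[ℂ] S} {RU : S →ₗ[ℂ] S} {QU : E →ₗ[ℂ] F} {KU HU : E →ₗ[ℂ] E}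
  {a γ β βK pK ρ CP : ℝ}
  {B₁kU : E →ₗ[ℂ] P} {B₁k'U : P →ₗ[ℂ] E} {B₂kU : E →ₗ[ℂ] S} {B₂k'U : S →ₗ[ℂ] E} {RkU : S →ₗ[ℂ] S}
  {QkU : E →ₗ[ℂ] F} {Qk'U : F →ₗ[ℂ] E} {KkU HkU : E →ₗ[ℂ] E}
  -- the family along the pencil (print's `U_z = U·e^{zηA}`, conjugated): one (CDA)-shaped structure per `z`
  {B₁kZ : ℂ → (E →ₗ[ℂ] P)} {B₁k'Z : ℂ → (P →ₗ[ℂ] E)} {B₂kZ : ℂ → (E →ₗ[ℂ] S)} {B₂k'Z : ℂ → (S →ₗ[ℂ] E)} {RkZ : ℂ → (S →ₗ[ℂ] S)}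
  {QkZ : ℂ → (E →ₗ[ℂ] F)} {Qk'Z : ℂ → (F →ₗ[ℂ] E)} {KkZ HkZ : ℂ → (E →ₗ[ℂ] E)}
  (ha : 0 ≤ a) (hβ : 0 ≤ β) (hρ : 0 ≤ ρ) (hρ8 : ρ ≤ 1 / 8) (hCP : 0 ≤ CP)
  (small' : 3 / 4 * pK + (21 + 3 * a) * β ^ 2 + 4 * β * CP + 2 * ρ * CP ^ 2 + βK ≤ γ / 8)
  -- the structure at the REAL base point `U` (every SIZE letter lives here)
  (hRsqU : ∀ s, RCLike.re ⟪s, RU s⟫_ℂ = ‖RU s‖ ^ 2) (hR1U : ∀ s, ‖RU s‖ ≤ ‖s‖)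
  (hHU : ∀ f, HU f = LinearMap.adjoint B₁U (B₁U f) + LinearMap.adjoint B₂U (RU (B₂U f)) + KU f + ((a : ℝ) : ℂ) • LinearMap.adjoint QU (QU f))
  (coerciveU : ∀ f, γ * ‖f‖ ^ 2 ≤ RCLike.re ⟪f, HU f⟫_ℂ) (hKreU : ∀ f, -(pK * ‖f‖ ^ 2) ≤ RCLike.re ⟪f, KU f⟫_ℂ)
  (hPU : ∀ f, ‖B₂U f - RU (B₂U f)‖ ≤ CP * ‖f‖)
  (dB₁U : ∀ f, ‖B₁kU f - B₁U f‖ ≤ β * ‖f‖) (dB₁'U : ∀ p, ‖B₁k'U p - LinearMap.adjoint B₁U p‖ ≤ β * ‖p‖)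
  (dB₂U : ∀ f, ‖B₂kU f - B₂U f‖ ≤ β * ‖f‖) (dB₂'U : ∀ s, ‖B₂k'U s - LinearMap.adjoint B₂U s‖ ≤ β * ‖s‖)
  (dRU : ∀ s, ‖RkU s - RU s‖ ≤ ρ * ‖s‖)
  (dQU : ∀ f, ‖QkU f - QU f‖ ≤ β * ‖f‖) (dQ'U : ∀ g, ‖Qk'U g - LinearMap.adjoint QU g‖ ≤ β * ‖g‖)
  (dKU : ∀ f, ‖KkU f - KU f‖ ≤ βK * ‖f‖)
  (hHkU : ∀ f, HkU f = B₁k'U (B₁kU f) + B₂k'U (RkU (B₂kU f)) + KkU f + ((a : ℝ) : ℂ) • Qk'U (QkU f))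
  -- the family's structure equation at every `z`
  (hHkZ : ∀ (z : ℂ) (f : E), HkZ z f = B₁k'Z z (B₁kZ z f) + B₂k'Z z (RkZ z (B₂kZ z f)) + KkZ z f + ((a : ℝ) : ℂ) • Qk'Z z (QkZ z f))
  -- the radius and the DIFFERENCE letters, uniform on the closed disc (no size letter at any complex member)
  {R₁ : ℝ} (hR₁ : 0 < R₁)
  {δ₁ δ₂ δR δQ δK : ℝ} (hδ₁ : 0 ≤ δ₁) (hδ₂ : 0 ≤ δ₂) (hδR : 0 ≤ δR) (hδQ : 0 ≤ δQ) (hδK : 0 ≤ δK)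
  (tB₁ : ∀ z : ℂ, ‖z‖ ≤ R₁ → ∀ f, ‖B₁kZ z f - B₁kU f‖ ≤ δ₁ * ‖f‖) (tB₁' : ∀ z : ℂ, ‖z‖ ≤ R₁ → ∀ p, ‖B₁k'Z z p - B₁k'U p‖ ≤ δ₁ * ‖p‖)
  (tB₂ : ∀ z : ℂ, ‖z‖ ≤ R₁ → ∀ f, ‖B₂kZ z f - B₂kU f‖ ≤ δ₂ * ‖f‖) (tB₂' : ∀ z : ℂ, ‖z‖ ≤ R₁ → ∀ s, ‖B₂k'Z z s - B₂k'U s‖ ≤ δ₂ * ‖s‖)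
  (tR : ∀ z : ℂ, ‖z‖ ≤ R₁ → ∀ s, ‖RkZ z s - RkU s‖ ≤ δR * ‖s‖)
  (tQ : ∀ z : ℂ, ‖z‖ ≤ R₁ → ∀ f, ‖QkZ z f - QkU f‖ ≤ δQ * ‖f‖) (tQ' : ∀ z : ℂ, ‖z‖ ≤ R₁ → ∀ g, ‖Qk'Z z g - Qk'U g‖ ≤ δQ * ‖g‖)
  (tK : ∀ z : ℂ, ‖z‖ ≤ R₁ → ∀ f, ‖KkZ z f - KkU f‖ ≤ δK * ‖f‖)
  -- analyticity of the family (at the lattice: a PAIR-typed chain of entire words in the pencil letters and their transposes; §1 reduces it to the letters)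
  (hHa : ∀ z : ℂ, ‖z‖ ≤ R₁ → AnalyticAt ℂ (fun w : ℂ => (LinearMap.toContinuousLinearMap (HkZ w) : E →L[ℂ] E)) z)
  -- the gap
  (hgap : (((1 + β) * δ₁ + δ₁ * (1 + β) + δ₁ * δ₁) +
          ((1 + CP + β) * ((1 + ρ) * δ₂ + δR * (1 + CP + β + δ₂)) + δ₂ * ((1 + ρ) * (1 + CP + β)) +
            δ₂ * ((1 + ρ) * δ₂ + δR * (1 + CP + β + δ₂))) +
          δK + ((Real.sqrt a + |a| * β) * δQ + δQ * (Real.sqrt a + |a| * β) + |a| * (δQ * δQ))) < min (1 / 4) (γ / 8))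

/-- The pencil's `hco` letter at the base: `γ′·N_U(u)² ≤ re⟪u, H_κ(U)u⟫`, `γ′ = min(¼, γ∕8)` (`…EnergyWeight.coerciveN_k`). [folklore]
[cite: Balaban1985BackgroundPropagators, (3.26) p.395, (3.49) p.399, Thm 3.11 p.416] -/
private theorem hco_aux (ha : 0 ≤ a) (hβ : 0 ≤ β) (hρ : 0 ≤ ρ) (hρ8 : ρ ≤ 1 / 8) (hCP : 0 ≤ CP)
    (small' : 3 / 4 * pK + (21 + 3 * a) * β ^ 2 + 4 * β * CP + 2 * ρ * CP ^ 2 + βK ≤ γ / 8)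
    (hRsqU : ∀ s, RCLike.re ⟪s, RU s⟫_ℂ = ‖RU s‖ ^ 2) (hR1U : ∀ s, ‖RU s‖ ≤ ‖s‖)
    (hHU : ∀ f, HU f = LinearMap.adjoint B₁U (B₁U f) + LinearMap.adjoint B₂U (RU (B₂U f)) + KU f + ((a : ℝ) : ℂ) • LinearMap.adjoint QU (QU f))
    (coerciveU : ∀ f, γ * ‖f‖ ^ 2 ≤ RCLike.re ⟪f, HU f⟫_ℂ) (hKreU : ∀ f, -(pK * ‖f‖ ^ 2) ≤ RCLike.re ⟪f, KU f⟫_ℂ)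
    (hPU : ∀ f, ‖B₂U f - RU (B₂U f)‖ ≤ CP * ‖f‖)
    (dB₁U : ∀ f, ‖B₁kU f - B₁U f‖ ≤ β * ‖f‖) (dB₁'U : ∀ p, ‖B₁k'U p - LinearMap.adjoint B₁U p‖ ≤ β * ‖p‖)
    (dB₂U : ∀ f, ‖B₂kU f - B₂U f‖ ≤ β * ‖f‖) (dB₂'U : ∀ s, ‖B₂k'U s - LinearMap.adjoint B₂U s‖ ≤ β * ‖s‖)
    (dRU : ∀ s, ‖RkU s - RU s‖ ≤ ρ * ‖s‖)
    (dQU : ∀ f, ‖QkU f - QU f‖ ≤ β * ‖f‖) (dQ'U : ∀ g, ‖Qk'U g - LinearMap.adjoint QU g‖ ≤ β * ‖g‖)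
    (dKU : ∀ f, ‖KkU f - KU f‖ ≤ βK * ‖f‖)
    (hHkU : ∀ f, HkU f = B₁k'U (B₁kU f) + B₂k'U (RkU (B₂kU f)) + KkU f + ((a : ℝ) : ℂ) • Qk'U (QkU f)) (u : E) :
    min (1 / 4) (γ / 8) * Real.sqrt (‖B₁U u‖ ^ 2 + ‖RU (B₂U u)‖ ^ 2 + a * ‖QU u‖ ^ 2 + ‖u‖ ^ 2) ^ 2 ≤
      RCLike.re ⟪u, (LinearMap.toContinuousLinearMap HkU : E →L[ℂ] E) u⟫_ℂ := by
  rw [LinearMap.coe_toContinuousLinearMap']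
  exact coerciveN_k B₁U B₂U RU QU KU HU a γ β βK pK ρ CP B₁kU B₁k'U B₂kU B₂k'U RkU QkU Qk'U KkU HkU ha hβ hρ hCP hRsqU hR1U hHU coerciveU hKreU
    dB₁U dB₁'U dB₂U dB₂'U dRU dQU dQ'U dKU small' hHkU hρ8 hPU u

omit [FiniteDimensional ℂ E] [FiniteDimensional ℂ P] [FiniteDimensional ℂ S] [FiniteDimensional ℂ F] in
include ha hβ hρ hCP hR1U hPU dB₂U dRU tB₂ tR hδ₂ hδR in
/-- **THE `R`-SLOT COMPOSITE DIFFERENCE LETTER FROM SIZES AT `U` ONLY**: on the disc,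
`‖R_κ(z)(B_{2,κ}(z)v) − R_κ(U)(B_{2,κ}(U)v)‖ ≤ ((1 + ρ)δ₂ + δ_R(1 + C_P + β + δ₂))·N_U(v)` — `(R_κ(z) − R_κ(U))(B_{2,κ}(z)v) + R_κ(U)((B_{2,κ}(z) − B_{2,κ}(U))v)`
with `‖R_κ(U)‖ ≤ 1 + ρ` and `‖B_{2,κ}(z)v‖ ≤ (1 + C_P + β + δ₂)N_U(v)`; NO contraction or unitarity of the complex member is used (compare
`…TwoBackgrounds.norm_Rk_B₂k_sub_le_weightU`, which uses `V`'s). [folklore] [cite: Balaban1985BackgroundPropagators, (3.50)–(3.53) p.400, (3.21) p.394, (3.49) p.399] -/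
theorem norm_Rk_B₂k_sub_le_weightU_base {z : ℂ} (hz : ‖z‖ ≤ R₁) (v : E) :
    ‖RkZ z (B₂kZ z v) - RkU (B₂kU v)‖ ≤ ((1 + ρ) * δ₂ + δR * (1 + CP + β + δ₂)) * Real.sqrt (‖B₁U v‖ ^ 2 + ‖RU (B₂U v)‖ ^ 2 + a * ‖QU v‖ ^ 2 + ‖v‖ ^ 2) := by
  have h1 := norm_B₂k_le_weightU B₁U B₂U RU QU a β CP B₂kU ha hβ hCP dB₂U hPU (𝕜 := ℂ) v
  have h2 := norm_le_weightU B₁U B₂U RU QU a ha (𝕜 := ℂ) v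
  have hW : 0 ≤ Real.sqrt (‖B₁U v‖ ^ 2 + ‖RU (B₂U v)‖ ^ 2 + a * ‖QU v‖ ^ 2 + ‖v‖ ^ 2) := Real.sqrt_nonneg _
  have hRkU : ∀ s, ‖RkU s‖ ≤ (1 + ρ) * ‖s‖ := fun s => by
    have := norm_add_le (RU s) (RkU s - RU s); rw [add_sub_cancel] at this
    nlinarith [hR1U s, dRU s]
  have hB : ‖B₂kZ z v‖ ≤ (1 + CP + β + δ₂) * Real.sqrt (‖B₁U v‖ ^ 2 + ‖RU (B₂U v)‖ ^ 2 + a * ‖QU v‖ ^ 2 + ‖v‖ ^ 2) := by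
    have := norm_add_le (B₂kU v) (B₂kZ z v - B₂kU v); rw [add_sub_cancel] at this
    nlinarith [tB₂ z hz v, mul_le_mul_of_nonneg_left h2 hδ₂]
  have e : RkZ z (B₂kZ z v) - RkU (B₂kU v) = (RkZ z - RkU) (B₂kZ z v) + RkU (B₂kZ z v - B₂kU v) := by
    rw [LinearMap.sub_apply, map_sub]; abel
  rw [e]
  calc ‖(RkZ z - RkU) (B₂kZ z v) + RkU (B₂kZ z v - B₂kU v)‖
      ≤ ‖(RkZ z - RkU) (B₂kZ z v)‖ + ‖RkU (B₂kZ z v - B₂kU v)‖ := norm_add_le _ _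
    _ ≤ δR * ‖B₂kZ z v‖ + (1 + ρ) * ‖B₂kZ z v - B₂kU v‖ :=
        add_le_add (by rw [LinearMap.sub_apply]; exact tR z hz _) (hRkU _)
    _ ≤ δR * ((1 + CP + β + δ₂) * Real.sqrt (‖B₁U v‖ ^ 2 + ‖RU (B₂U v)‖ ^ 2 + a * ‖QU v‖ ^ 2 + ‖v‖ ^ 2)) + (1 + ρ) * (δ₂ * Real.sqrt (‖B₁U v‖ ^ 2 + ‖RU (B₂U v)‖ ^ 2 + a * ‖QU v‖ ^ 2 + ‖v‖ ^ 2)) :=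
        add_le_add (mul_le_mul_of_nonneg_left hB hδR)
          (mul_le_mul_of_nonneg_left ((tB₂ z hz v).trans (mul_le_mul_of_nonneg_left h2 hδ₂)) (by linarith))
    _ = ((1 + ρ) * δ₂ + δR * (1 + CP + β + δ₂)) * Real.sqrt (‖B₁U v‖ ^ 2 + ‖RU (B₂U v)‖ ^ 2 + a * ‖QU v‖ ^ 2 + ‖v‖ ^ 2) := by ring

include ha hβ hρ hCP hR1U hPU dB₁U dB₁'U dB₂U dB₂'U dRU dQU dQ'U hHkU hHkZ hδ₁ hδ₂ hδR hδQ hδK tB₁ tB₁' tB₂ tB₂' tR tQ tQ' tK in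
/-- The pencil's `hDΘ` letter, UNIFORM ON THE DISC: `‖⟪u, (H_κ(U_z) − H_κ(U))v⟫‖ ≤ Θ·N_U(u)N_U(v)` for `‖z‖ ≤ R₁`, with every size at `U`
(`…FormDefect.norm_inner_conjH_sub_conjH_le` on `…TwoBackgrounds`' §1 size letters, §1's composite and the difference letters). [folklore]
[cite: Balaban1985BackgroundPropagators, (3.52)–(3.53) p.400, (3.84) p.407, (3.49) p.399] -/
private theorem hD_aux (z : ℂ) (hz : ‖z‖ ≤ R₁) (u v : E) :
    ‖⟪u, ((LinearMap.toContinuousLinearMap (HkZ z) : E →L[ℂ] E) - (LinearMap.toContinuousLinearMap HkU : E →L[ℂ] E)) v⟫_ℂ‖ ≤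
      (((1 + β) * δ₁ + δ₁ * (1 + β) + δ₁ * δ₁) +
          ((1 + CP + β) * ((1 + ρ) * δ₂ + δR * (1 + CP + β + δ₂)) + δ₂ * ((1 + ρ) * (1 + CP + β)) +
            δ₂ * ((1 + ρ) * δ₂ + δR * (1 + CP + β + δ₂))) +
          δK + ((Real.sqrt a + |a| * β) * δQ + δQ * (Real.sqrt a + |a| * β) + |a| * (δQ * δQ))) *
        Real.sqrt (‖B₁U u‖ ^ 2 + ‖RU (B₂U u)‖ ^ 2 + a * ‖QU u‖ ^ 2 + ‖u‖ ^ 2) * Real.sqrt (‖B₁U v‖ ^ 2 + ‖RU (B₂U v)‖ ^ 2 + a * ‖QU v‖ ^ 2 + ‖v‖ ^ 2) := by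
  rw [sub_apply, LinearMap.coe_toContinuousLinearMap', LinearMap.coe_toContinuousLinearMap', inner_sub_right,
    norm_sub_rev]
  have hNU0 := weightU_nonneg B₁U B₂U RU QU a (𝕜 := ℂ)
  have hNUn := norm_le_weightU B₁U B₂U RU QU a ha (𝕜 := ℂ)
  have s₁ := norm_B₁k_le_weightU B₁U B₂U RU QU a β B₁kU ha hβ dB₁U (𝕜 := ℂ)
  have s₁' := norm_adjoint_B₁k'_le_weightU B₁U B₂U RU QU a β B₁k'U ha hβ dB₁'U
  have s₂ := norm_Rk_B₂k_le_weightU B₁U B₂U RU QU a β ρ CP B₂kU RkU ha hβ hρ hCP hR1U dB₂U dRU hPU (𝕜 := ℂ)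
  have s₂' := norm_adjoint_B₂k'_le_weightU B₁U B₂U RU QU a β CP B₂k'U ha hβ hCP dB₂'U hPU
  have sQ := abs_mul_norm_Qk_le_weightU B₁U B₂U RU QU a β QkU ha hβ dQU (𝕜 := ℂ)
  have sQ' := abs_mul_norm_adjoint_Qk'_le_weightU B₁U B₂U RU QU a β Qk'U ha hβ dQ'U
  have e₁ : ∀ v, ‖B₁kZ z v - B₁kU v‖ ≤ δ₁ * Real.sqrt (‖B₁U v‖ ^ 2 + ‖RU (B₂U v)‖ ^ 2 + a * ‖QU v‖ ^ 2 + ‖v‖ ^ 2) :=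
    fun v => (tB₁ z hz v).trans (mul_le_mul_of_nonneg_left (hNUn v) hδ₁)
  have e₁' : ∀ u, ‖LinearMap.adjoint (B₁k'Z z) u - LinearMap.adjoint B₁k'U u‖ ≤ δ₁ * Real.sqrt (‖B₁U u‖ ^ 2 + ‖RU (B₂U u)‖ ^ 2 + a * ‖QU u‖ ^ 2 + ‖u‖ ^ 2) :=
    fun u => (norm_adjoint_sub_adjoint_le hδ₁ (tB₁' z hz) u).trans (mul_le_mul_of_nonneg_left (hNUn u) hδ₁)
  have e₂ := norm_Rk_B₂k_sub_le_weightU_base (B₁U := B₁U) (QU := QU) ha hβ hρ hCP hR1U hPU dB₂U dRU hδ₂ hδR tB₂ tR hz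
  have e₂' : ∀ u, ‖LinearMap.adjoint (B₂k'Z z) u - LinearMap.adjoint B₂k'U u‖ ≤ δ₂ * Real.sqrt (‖B₁U u‖ ^ 2 + ‖RU (B₂U u)‖ ^ 2 + a * ‖QU u‖ ^ 2 + ‖u‖ ^ 2) :=
    fun u => (norm_adjoint_sub_adjoint_le hδ₂ (tB₂' z hz) u).trans (mul_le_mul_of_nonneg_left (hNUn u) hδ₂)
  have eQ : ∀ v, ‖QkZ z v - QkU v‖ ≤ δQ * Real.sqrt (‖B₁U v‖ ^ 2 + ‖RU (B₂U v)‖ ^ 2 + a * ‖QU v‖ ^ 2 + ‖v‖ ^ 2) :=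
    fun v => (tQ z hz v).trans (mul_le_mul_of_nonneg_left (hNUn v) hδQ)
  have eQ' : ∀ u, ‖LinearMap.adjoint (Qk'Z z) u - LinearMap.adjoint Qk'U u‖ ≤ δQ * Real.sqrt (‖B₁U u‖ ^ 2 + ‖RU (B₂U u)‖ ^ 2 + a * ‖QU u‖ ^ 2 + ‖u‖ ^ 2) :=
    fun u => (norm_adjoint_sub_adjoint_le hδQ (tQ' z hz) u).trans (mul_le_mul_of_nonneg_left (hNUn u) hδQ)
  have eK : ∀ v, ‖KkZ z v - KkU v‖ ≤ δK * Real.sqrt (‖B₁U v‖ ^ 2 + ‖RU (B₂U v)‖ ^ 2 + a * ‖QU v‖ ^ 2 + ‖v‖ ^ 2) :=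
    fun v => (tK z hz v).trans (mul_le_mul_of_nonneg_left (hNUn v) hδK)
  exact norm_inner_conjH_sub_conjH_le hHkU (hHkZ z) (fun f => Real.sqrt (‖B₁U f‖ ^ 2 + ‖RU (B₂U f)‖ ^ 2 + a * ‖QU f‖ ^ 2 + ‖f‖ ^ 2)) hNU0 hNUn
    (by positivity) (by positivity) (by positivity) hδ₁ hδ₂ hδQ s₁ s₁' s₂ s₂' sQ sQ' e₁ e₁' e₂ e₂' eQ eQ' eK u v

include hHa in
/-- The pencil's `hDa` letter: `D(z) := H_κ(U_z) − H_κ(U)` is analytic on the disc when the family is. [folklore]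
[cite: Balaban1985BackgroundPropagators, Thm 3.4 p.400, (3.53) p.400] -/
private theorem hDa_aux : ∀ z : ℂ, ‖z‖ ≤ R₁ →
    AnalyticAt ℂ (fun w : ℂ => (LinearMap.toContinuousLinearMap (HkZ w) : E →L[ℂ] E) - (LinearMap.toContinuousLinearMap HkU : E →L[ℂ] E)) z :=
  fun z hz => (hHa z hz).sub analyticAt_const

/-- The pencil through the base: `H_κ(U) + (H_κ(U_w) − H_κ(U)) = H_κ(U_w)`. [folklore] [cite: Balaban1985BackgroundPropagators, (3.53) p.400] -/
private theorem pencil_eq (w : ℂ) : (LinearMap.toContinuousLinearMap HkU : E →L[ℂ] E) + ((LinearMap.toContinuousLinearMap (HkZ w) : E →L[ℂ] E) - (LinearMap.toContinuousLinearMap HkU : E →L[ℂ] E)) = (LinearMap.toContinuousLinearMap (HkZ w) : E →L[ℂ] E) :=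
  add_sub_cancel _ _

include hHkZ in
/-- **THE FAMILY IS ANALYTIC WHEN ITS LETTERS ARE** (supplier of `hHa`): if the eight letter families `w ↦ B_{1,κ}(w), B′_{1,κ}(w), B_{2,κ}(w),
B′_{2,κ}(w), R_κ(w), Q_κ(w), Q′_κ(w), K_κ(w)` are analytic at `z` as operator-valued maps, so is `w ↦ H_κ(U_w)` — the structure equation read as
`H = B′₁∘B₁ + B′₂∘R∘B₂ + K + a•Q′∘Q` in `E →L[ℂ] E` and Mathlib's `compL.analyticAt_bilinear.comp₂` ∕ `add` ∕ `smul`; the primed families are SEPARATE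
letters (transposes at the lattice, NOT Hilbert adjoints — those are only real-analytic in `w`).  At the lattice each letter family is a
finite matrix of entire words in the letters and their transposes (`B9Eq350GroupPencilLettersEntire`); that bookkeeping is NOT here. [folklore]
[cite: Balaban1985BackgroundPropagators, Thm 3.4 p.400 («analytic functions of A»), (3.50)–(3.53) p.400] -/
theorem analyticAt_conjH_of_letters {z : ℂ}
    (hB₁ : AnalyticAt ℂ (fun w : ℂ => (LinearMap.toContinuousLinearMap (B₁kZ w) : E →L[ℂ] P)) z)
    (hB₁' : AnalyticAt ℂ (fun w : ℂ => (LinearMap.toContinuousLinearMap (B₁k'Z w) : P →L[ℂ] E)) z)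
    (hB₂ : AnalyticAt ℂ (fun w : ℂ => (LinearMap.toContinuousLinearMap (B₂kZ w) : E →L[ℂ] S)) z)
    (hB₂' : AnalyticAt ℂ (fun w : ℂ => (LinearMap.toContinuousLinearMap (B₂k'Z w) : S →L[ℂ] E)) z)
    (hR : AnalyticAt ℂ (fun w : ℂ => (LinearMap.toContinuousLinearMap (RkZ w) : S →L[ℂ] S)) z)
    (hQ : AnalyticAt ℂ (fun w : ℂ => (LinearMap.toContinuousLinearMap (QkZ w) : E →L[ℂ] F)) z)
    (hQ' : AnalyticAt ℂ (fun w : ℂ => (LinearMap.toContinuousLinearMap (Qk'Z w) : F →L[ℂ] E)) z)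
    (hK : AnalyticAt ℂ (fun w : ℂ => (LinearMap.toContinuousLinearMap (KkZ w) : E →L[ℂ] E)) z) :
    AnalyticAt ℂ (fun w : ℂ => (LinearMap.toContinuousLinearMap (HkZ w) : E →L[ℂ] E)) z := by
  have e : (fun w : ℂ => (LinearMap.toContinuousLinearMap (HkZ w) : E →L[ℂ] E)) = fun w : ℂ =>
      (LinearMap.toContinuousLinearMap (B₁k'Z w) : P →L[ℂ] E).comp (LinearMap.toContinuousLinearMap (B₁kZ w) : E →L[ℂ] P) +
        (LinearMap.toContinuousLinearMap (B₂k'Z w) : S →L[ℂ] E).comp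
          ((LinearMap.toContinuousLinearMap (RkZ w) : S →L[ℂ] S).comp (LinearMap.toContinuousLinearMap (B₂kZ w) : E →L[ℂ] S)) +
        (LinearMap.toContinuousLinearMap (KkZ w) : E →L[ℂ] E) +
        ((a : ℝ) : ℂ) • (LinearMap.toContinuousLinearMap (Qk'Z w) : F →L[ℂ] E).comp (LinearMap.toContinuousLinearMap (QkZ w) : E →L[ℂ] F) := by
    funext w
    ext f
    show HkZ w f = _
    rw [hHkZ]
    rfl
  rw [e]
  exact (((analyticAt_clm_comp hB₁' hB₁).add (analyticAt_clm_comp hB₂' (analyticAt_clm_comp hR hB₂))).add hK).add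
    ((analyticAt_const (v := ((a : ℝ) : ℂ))).smul (analyticAt_clm_comp hQ' hQ))

/-! ## §2 THE END: `B9Eq386GreenGroupPencilEnergy` §2 applied BY NAME with `S₀ := H_κ(U)`, `D(z) := H_κ(U_z) − H_κ(U)` -/

include ha hβ hρ hρ8 hCP small' hRsqU hR1U hHU coerciveU hKreU hPU dB₁U dB₁'U dB₂U dB₂'U dRU dQU dQ'U dKU hHkU hHkZ hδ₁ hδ₂ hδR hδQ hδK tB₁ tB₁' tB₂ tB₂' tR tQ tQ' tK hgap in
/-- **UNIFORM INVERSE BOUND ALONG THE PENCIL**: `‖H_κ(U_z)⁻¹‖ ≤ (γ′ − Θ)⁻¹` for `‖z‖ ≤ R₁` — every complex member is inverted from the base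
point's coercivity and the disc-uniform form defect alone. [folklore] [cite: Balaban1985BackgroundPropagators, Thm 3.4 p.400, (3.86) p.407, Thm 3.11 p.416; Kato1966, Ch. VII §4] -/
theorem norm_inverse_conjH_gpencil_le {z : ℂ} (hz : ‖z‖ ≤ R₁) :
    ‖Ring.inverse (LinearMap.toContinuousLinearMap (HkZ z) : E →L[ℂ] E)‖ ≤ (min (1 / 4) (γ / 8) - (((1 + β) * δ₁ + δ₁ * (1 + β) + δ₁ * δ₁) +
          ((1 + CP + β) * ((1 + ρ) * δ₂ + δR * (1 + CP + β + δ₂)) + δ₂ * ((1 + ρ) * (1 + CP + β)) +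
            δ₂ * ((1 + ρ) * δ₂ + δR * (1 + CP + β + δ₂))) +
          δK + ((Real.sqrt a + |a| * β) * δQ + δQ * (Real.sqrt a + |a| * β) + |a| * (δQ * δQ))))⁻¹ := by
  have h := norm_inverse_apencil_le _ (weightU_nonneg B₁U B₂U RU QU a) (norm_le_weightU B₁U B₂U RU QU a ha) hgap
    (LinearMap.toContinuousLinearMap HkU : E →L[ℂ] E)
    (fun w : ℂ => (LinearMap.toContinuousLinearMap (HkZ w) : E →L[ℂ] E) - (LinearMap.toContinuousLinearMap HkU : E →L[ℂ] E))
    (hco_aux ha hβ hρ hρ8 hCP small' hRsqU hR1U hHU coerciveU hKreU hPU dB₁U dB₁'U dB₂U dB₂'U dRU dQU dQ'U dKU hHkU)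
    (hD_aux ha hβ hρ hCP hR1U hPU dB₁U dB₁'U dB₂U dB₂'U dRU dQU dQ'U hHkU hHkZ hδ₁ hδ₂ hδR hδQ hδK tB₁ tB₁' tB₂ tB₂' tR tQ tQ' tK) hz
  simpa only [pencil_eq] using h

include ha hβ hρ hρ8 hCP small' hRsqU hR1U hHU coerciveU hKreU hPU dB₁U dB₁'U dB₂U dB₂'U dRU dQU dQ'U dKU hHkU hHkZ hδ₁ hδ₂ hδR hδQ hδK tB₁ tB₁' tB₂ tB₂' tR tQ tQ' tK hHa hgap in
/-- **ANALYTICITY ALONG THE PENCIL**: `z ↦ H_κ(U_z)⁻¹` is analytic at every point of the closed disc. [folklore]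
[cite: Balaban1985BackgroundPropagators, Thm 3.4 p.400 («analytic functions of A»), (3.86) p.407; Kato1966, Ch. VII §4] -/
theorem analyticAt_inverse_conjH_gpencil {z : ℂ} (hz : ‖z‖ ≤ R₁) :
    AnalyticAt ℂ (fun w : ℂ => Ring.inverse (LinearMap.toContinuousLinearMap (HkZ w) : E →L[ℂ] E)) z := by
  have h := analyticAt_inverse_apencil _ (norm_le_weightU B₁U B₂U RU QU a ha) hgap
    (LinearMap.toContinuousLinearMap HkU : E →L[ℂ] E)
    (fun w : ℂ => (LinearMap.toContinuousLinearMap (HkZ w) : E →L[ℂ] E) - (LinearMap.toContinuousLinearMap HkU : E →L[ℂ] E))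
    (hco_aux ha hβ hρ hρ8 hCP small' hRsqU hR1U hHU coerciveU hKreU hPU dB₁U dB₁'U dB₂U dB₂'U dRU dQU dQ'U dKU hHkU)
    (hD_aux ha hβ hρ hCP hR1U hPU dB₁U dB₁'U dB₂U dB₂'U dRU dQU dQ'U hHkU hHkZ hδ₁ hδ₂ hδR hδQ hδK tB₁ tB₁' tB₂ tB₂' tR tQ tQ' tK) (hDa_aux hHa) hz
  simpa only [pencil_eq] using h

include ha hβ hρ hρ8 hCP small' hRsqU hR1U hHU coerciveU hKreU hPU dB₁U dB₁'U dB₂U dB₂'U dRU dQU dQ'U dKU hHkU hHkZ hδ₁ hδ₂ hδR hδQ hδK tB₁ tB₁' tB₂ tB₂' tR tQ tQ' tK hHa hgap in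
/-- **THE RESOLVENT DERIVATIVE ALONG THE PENCIL**: `(H_κ(U_·)⁻¹)′(z) = −H_κ(U_z)⁻¹·H_κ′(z)·H_κ(U_z)⁻¹` ((3.86) differentiated; the inverse a unit). [folklore]
[cite: Balaban1985BackgroundPropagators, (3.86) p.407; Kato1966, Ch. VII §4] -/
theorem hasDerivAt_inverse_conjH_gpencil {z : ℂ} (hz : ‖z‖ ≤ R₁) :
    HasDerivAt (fun w : ℂ => Ring.inverse (LinearMap.toContinuousLinearMap (HkZ w) : E →L[ℂ] E))
      (-(Ring.inverse (LinearMap.toContinuousLinearMap (HkZ z) : E →L[ℂ] E) * deriv (fun w : ℂ => (LinearMap.toContinuousLinearMap (HkZ w) : E →L[ℂ] E)) z *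
        Ring.inverse (LinearMap.toContinuousLinearMap (HkZ z) : E →L[ℂ] E))) z := by
  have h := hasDerivAt_inverse_apencil _ (norm_le_weightU B₁U B₂U RU QU a ha) hgap
    (LinearMap.toContinuousLinearMap HkU : E →L[ℂ] E)
    (fun w : ℂ => (LinearMap.toContinuousLinearMap (HkZ w) : E →L[ℂ] E) - (LinearMap.toContinuousLinearMap HkU : E →L[ℂ] E))
    (hco_aux ha hβ hρ hρ8 hCP small' hRsqU hR1U hHU coerciveU hKreU hPU dB₁U dB₁'U dB₂U dB₂'U dRU dQU dQ'U dKU hHkU)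
    (hD_aux ha hβ hρ hCP hR1U hPU dB₁U dB₁'U dB₂U dB₂'U dRU dQU dQ'U hHkU hHkZ hδ₁ hδ₂ hδR hδQ hδK tB₁ tB₁' tB₂ tB₂' tR tQ tQ' tK) (hDa_aux hHa) hz
  have hd : deriv (fun w : ℂ => (LinearMap.toContinuousLinearMap (HkZ w) : E →L[ℂ] E) - (LinearMap.toContinuousLinearMap HkU : E →L[ℂ] E)) z = deriv (fun w : ℂ => (LinearMap.toContinuousLinearMap (HkZ w) : E →L[ℂ] E)) z :=
    deriv_sub_const _
  simpa only [pencil_eq, hd] using h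

include ha hβ hρ hρ8 hCP small' hRsqU hR1U hHU coerciveU hKreU hPU dB₁U dB₁'U dB₂U dB₂'U dRU dQU dQ'U dKU hHkU hHkZ hδ₁ hδ₂ hδR hδQ hδK tB₁ tB₁' tB₂ tB₂' tR tQ tQ' tK hHa hR₁ hgap in
/-- **CAUCHY AT EVERY ORDER AT THE BASE**: `‖iteratedDeriv n (z ↦ H_κ(U_z)⁻¹) 0‖ ≤ n!·(γ′ − Θ)⁻¹∕R₁ⁿ` — the Taylor coefficients of the conjugated
propagator in the pencil direction (print's «analytic functions of A», one complex line) are majorised geometrically with ratio `R₁⁻¹`; with the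
letters uniform on a Combes–Thomas circle the read-out `B9Eq349BondBlockDecayFromCircle.norm_bondBlock_le_exp_of_uniform_circle_bound` applies ORDER BY
ORDER (not valued here). [folklore] [cite: Balaban1985BackgroundPropagators, Thm 3.4 p.400, (3.86) p.407, Thm 3.11 p.416; Kato1966, Ch. VII §4] -/
theorem norm_iteratedDeriv_inverse_conjH_gpencil_le (n : ℕ) :
    ‖iteratedDeriv n (fun w : ℂ => Ring.inverse (LinearMap.toContinuousLinearMap (HkZ w) : E →L[ℂ] E)) 0‖ ≤ n.factorial * (min (1 / 4) (γ / 8) - (((1 + β) * δ₁ + δ₁ * (1 + β) + δ₁ * δ₁) +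
          ((1 + CP + β) * ((1 + ρ) * δ₂ + δR * (1 + CP + β + δ₂)) + δ₂ * ((1 + ρ) * (1 + CP + β)) +
            δ₂ * ((1 + ρ) * δ₂ + δR * (1 + CP + β + δ₂))) +
          δK + ((Real.sqrt a + |a| * β) * δQ + δQ * (Real.sqrt a + |a| * β) + |a| * (δQ * δQ))))⁻¹ / R₁ ^ n := by
  have h := norm_iteratedDeriv_inverse_apencil_le _ (weightU_nonneg B₁U B₂U RU QU a) (norm_le_weightU B₁U B₂U RU QU a ha) hR₁ hgap
    (LinearMap.toContinuousLinearMap HkU : E →L[ℂ] E)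
    (fun w : ℂ => (LinearMap.toContinuousLinearMap (HkZ w) : E →L[ℂ] E) - (LinearMap.toContinuousLinearMap HkU : E →L[ℂ] E))
    (hco_aux ha hβ hρ hρ8 hCP small' hRsqU hR1U hHU coerciveU hKreU hPU dB₁U dB₁'U dB₂U dB₂'U dRU dQU dQ'U dKU hHkU)
    (hD_aux ha hβ hρ hCP hR1U hPU dB₁U dB₁'U dB₂U dB₂'U dRU dQU dQ'U hHkU hHkZ hδ₁ hδ₂ hδR hδQ hδK tB₁ tB₁' tB₂ tB₂' tR tQ tQ' tK) (hDa_aux hHa) n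
  simpa only [pencil_eq] using h

include ha hβ hρ hρ8 hCP small' hRsqU hR1U hHU coerciveU hKreU hPU dB₁U dB₁'U dB₂U dB₂'U dRU dQU dQ'U dKU hHkU hHkZ hδ₁ hδ₂ hδR hδQ hδK tB₁ tB₁' tB₂ tB₂' tR tQ tQ' tK hHa hgap in
/-- **TWO BACKGROUNDS ON THE PENCIL DIFFER BY A LIPSCHITZ AMOUNT**: for `r < R₁` and `‖z‖, ‖w‖ ≤ r`,
`‖H_κ(U_z)⁻¹ − H_κ(U_w)⁻¹‖ ≤ (γ′ − Θ)⁻¹∕(R₁ − r)·‖z − w‖` — no weight comparison, no unconjugated letter, no size letter at any complex member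
(compare `…TwoBackgrounds.norm_conjGk_sub_conjGk_le` and `…TwoBackgroundsPencil.norm_inverse_conjH_sub_inverse_conjH_le`). [folklore]
[cite: Balaban1985BackgroundPropagators, Thm 3.4 p.400 («small perturbations of the operators depending on U only»), (3.86) p.407; Kato1966, Ch. VII §4] -/
theorem norm_inverse_conjH_gpencil_sub_le {r : ℝ} (hr : r < R₁) {z w : ℂ} (hz : ‖z‖ ≤ r) (hw : ‖w‖ ≤ r) :
    ‖Ring.inverse (LinearMap.toContinuousLinearMap (HkZ z) : E →L[ℂ] E) - Ring.inverse (LinearMap.toContinuousLinearMap (HkZ w) : E →L[ℂ] E)‖ ≤ (min (1 / 4) (γ / 8) - (((1 + β) * δ₁ + δ₁ * (1 + β) + δ₁ * δ₁) +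
          ((1 + CP + β) * ((1 + ρ) * δ₂ + δR * (1 + CP + β + δ₂)) + δ₂ * ((1 + ρ) * (1 + CP + β)) +
            δ₂ * ((1 + ρ) * δ₂ + δR * (1 + CP + β + δ₂))) +
          δK + ((Real.sqrt a + |a| * β) * δQ + δQ * (Real.sqrt a + |a| * β) + |a| * (δQ * δQ))))⁻¹ / (R₁ - r) * ‖z - w‖ := by
  have h := norm_inverse_sub_inverse_apencil_le _ (weightU_nonneg B₁U B₂U RU QU a) (norm_le_weightU B₁U B₂U RU QU a ha) hgap
    (LinearMap.toContinuousLinearMap HkU : E →L[ℂ] E)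
    (fun w : ℂ => (LinearMap.toContinuousLinearMap (HkZ w) : E →L[ℂ] E) - (LinearMap.toContinuousLinearMap HkU : E →L[ℂ] E))
    (hco_aux ha hβ hρ hρ8 hCP small' hRsqU hR1U hHU coerciveU hKreU hPU dB₁U dB₁'U dB₂U dB₂'U dRU dQU dQ'U dKU hHkU)
    (hD_aux ha hβ hρ hCP hR1U hPU dB₁U dB₁'U dB₂U dB₂'U dRU dQU dQ'U hHkU hHkZ hδ₁ hδ₂ hδR hδQ hδK tB₁ tB₁' tB₂ tB₂' tR tQ tQ' tK) (hDa_aux hHa) hr hz hw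
  simpa only [pencil_eq] using h

include ha hβ hρ hρ8 hCP small' hRsqU hR1U hHU coerciveU hKreU hPU dB₁U dB₁'U dB₂U dB₂'U dRU dQU dQ'U dKU hHkU hHkZ hδ₁ hδ₂ hδR hδQ hδK tB₁ tB₁' tB₂ tB₂' tR tQ tQ' tK hgap in
/-- **THE ROWS RIDE ALONG THE PENCIL**: `N_U(H_κ(U_z)⁻¹y) ≤ (γ′ − Θ)⁻¹‖y‖` for `‖z‖ ≤ R₁` — the energy row at the BASE weight for every member, the
input of the circle read-out. [folklore] [cite: Balaban1985BackgroundPropagators, Thm 3.4 p.400, (3.49) p.399, Thm 3.11 p.416] -/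
theorem weightU_inverse_conjH_gpencil_apply_le {z : ℂ} (hz : ‖z‖ ≤ R₁) (y : E) :
    Real.sqrt (‖B₁U (Ring.inverse (LinearMap.toContinuousLinearMap (HkZ z) : E →L[ℂ] E) y)‖ ^ 2 + ‖RU (B₂U (Ring.inverse (LinearMap.toContinuousLinearMap (HkZ z) : E →L[ℂ] E) y))‖ ^ 2 + a * ‖QU (Ring.inverse (LinearMap.toContinuousLinearMap (HkZ z) : E →L[ℂ] E) y)‖ ^ 2 + ‖(Ring.inverse (LinearMap.toContinuousLinearMap (HkZ z) : E →L[ℂ] E) y)‖ ^ 2) ≤ (min (1 / 4) (γ / 8) - (((1 + β) * δ₁ + δ₁ * (1 + β) + δ₁ * δ₁) +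
          ((1 + CP + β) * ((1 + ρ) * δ₂ + δR * (1 + CP + β + δ₂)) + δ₂ * ((1 + ρ) * (1 + CP + β)) +
            δ₂ * ((1 + ρ) * δ₂ + δR * (1 + CP + β + δ₂))) +
          δK + ((Real.sqrt a + |a| * β) * δQ + δQ * (Real.sqrt a + |a| * β) + |a| * (δQ * δQ))))⁻¹ * ‖y‖ := by
  have h := weight_inverse_apencil_apply_le _ (weightU_nonneg B₁U B₂U RU QU a) (norm_le_weightU B₁U B₂U RU QU a ha) hgap
    (LinearMap.toContinuousLinearMap HkU : E →L[ℂ] E)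
    (fun w : ℂ => (LinearMap.toContinuousLinearMap (HkZ w) : E →L[ℂ] E) - (LinearMap.toContinuousLinearMap HkU : E →L[ℂ] E))
    (hco_aux ha hβ hρ hρ8 hCP small' hRsqU hR1U hHU coerciveU hKreU hPU dB₁U dB₁'U dB₂U dB₂'U dRU dQU dQ'U dKU hHkU)
    (hD_aux ha hβ hρ hCP hR1U hPU dB₁U dB₁'U dB₂U dB₂'U dRU dQU dQ'U hHkU hHkZ hδ₁ hδ₂ hδR hδQ hδK tB₁ tB₁' tB₂ tB₂' tR tQ tQ' tK) hz y
  simpa only [pencil_eq] using h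

end GroupPencil

end Literature.MathematicalPhysics.QuantumFieldTheory.Balaban1983to89.B9Eq326ConjugatedDeltaATwoBackgroundsGroupPencil

end
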